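import Summits.AtomisticToContinuum.BoseEinsteinCondensation.Theorems.BECGroundStateSOSBoundaryTransferWeakHardWallLimitBounded
import Summits.AtomisticToContinuum.BoseEinsteinCondensation.Theorems.BECCutLineWeakDisorderGroundStateRigidityStubPairCutoff
import Summits.AtomisticToContinuum.BoseEinsteinCondensation.Theorems.BECCutLineWeakDisorderGroundStateRigidityStubTruncHigh
import Summits.AtomisticToContinuum.BoseEinsteinCondensation.Theorems.BECCutLineWeakDisorderGroundStateRigidityStubEnergyTruncAux

/-!
# Route `BECGroundStateSOS`, crux `BoundaryTransferWeak` (stmt-AtomisticToContinuum-0827),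
# line `rim-squeeze-monotone-coherence`, stub (L) for locally bounded potentials, I:
# the pair-collision cutoff and the shrink off the collision set

Supports (does not close) stmt-AtomisticToContinuum-0827; first auxiliary block of the registered
stub `stub_hardWallLimit_locallyBounded` (L, locally-bounded class; lead c3). By the landed
`stub_hardWallLimit_aux` that stub reduces to a near-minimiser transfer across the hard wall; the
landed bounded-`v` chain (`transfer_chain`: rim cut-off → dilation → `L²` modulus) used
boundedness of `v` only in the dilation. For `v` bounded on every `(δ, ∞)` but possibly singular at
`r → 0` one inserts, before dilating, the PAIR-COLLISION CUTOFF of stmt-9072: this file proves it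
for an arbitrary bounded-energy Dirichlet trial state `Φ` (not only for near-minimisers) at fixed
data — amplitude truncation `g` of `Φ` (`stub_truncHigh`, `|g| ≤ B`, `∫|g - Φ|² ≤ ηt`), smooth
symmetric collision cutoff `χ` (`stub_pairCutoff`, `vol{χ ≠ 1} ≤ Aε₁`, `∫|∇χ|² ≤ Aε₁`), cut state
`f = χ g` with `Q_v(f) ≤ (1+θ)𝓔_v[Φ] + (1+θ⁻¹)B²Aε₁` (`EnergyTrunc.form_le`; on `supp χ` the
interaction is the truncated one) and `1 ≤ (1+θ)‖f‖² + 2(1+θ⁻¹)(ηt + B²Aε₁)`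
(`EnergyTrunc.mass_le`), normalised (`exists_normalize`): energy `≤ 𝓔_v[Φ] + τ`, `L²`-distance²
`≤ τ` (`lintegral_cut_sub_sq_le`), support off `{∃ i ≠ j, |xᵢ - xⱼ| ≤ ε₁}`
(`stub_hardWallLimit_locallyBounded_aux`). The parameter choice and the dilation off the collision
set are the sequels. All `[folklore]` / LSSY Thm 2.4.
-/

noncomputable section

namespace Summit.AtomisticToContinuum.BoseEinsteinCondensation.RimSqueeze

open Literature.MathematicalPhysics.QuantumManyBody.BoseGas
open MeasureTheory Filter Set
open scoped ENNReal NNReal ComplexConjugate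
open Summit.AtomisticToContinuum.BoseEinsteinCondensation.Theorems.GroundStateRigidity
  (stub_pairCutoff stub_truncHigh)
open Summit.AtomisticToContinuum.BoseEinsteinCondensation.Theorems.GroundStateRigidity.EnergyTrunc
  (form_le mass_le nnnorm_cut_le interaction_eq_trunc coe_nnreal_sq groundStateEnergy_mono)

variable {N : ℕ}

/-! ### Small facts -/

/-- `‖a - d‖² ≤ 3‖a - b‖² + 3‖b - c‖² + 3‖c - d‖²` in `ℝ≥0∞`. [folklore] -/
theorem ennnorm_sub_sq_le_three (a b c d : ℂ) :
    ((‖a - d‖₊ : ℝ≥0∞)) ^ 2 ≤ 3 * (‖a - b‖₊ : ℝ≥0∞) ^ 2 + 3 * (‖b - c‖₊ : ℝ≥0∞) ^ 2 +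
      3 * (‖c - d‖₊ : ℝ≥0∞) ^ 2 := by
  have h1 : ‖a - d‖ ≤ ‖a - b‖ + ‖b - c‖ + ‖c - d‖ := by
    calc ‖a - d‖ = ‖(a - b) + (b - c) + (c - d)‖ := by congr 1; ring
      _ ≤ ‖(a - b) + (b - c)‖ + ‖c - d‖ := norm_add_le _ _
      _ ≤ ‖a - b‖ + ‖b - c‖ + ‖c - d‖ := add_le_add (norm_add_le _ _) le_rfl
  have h2 : ‖a - d‖ ^ 2 ≤ 3 * ‖a - b‖ ^ 2 + 3 * ‖b - c‖ ^ 2 + 3 * ‖c - d‖ ^ 2 := by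
    have h3 : ‖a - d‖ ^ 2 ≤ (‖a - b‖ + ‖b - c‖ + ‖c - d‖) ^ 2 :=
      pow_le_pow_left₀ (norm_nonneg _) h1 2
    nlinarith [sq_nonneg (‖a - b‖ - ‖b - c‖), sq_nonneg (‖b - c‖ - ‖c - d‖),
      sq_nonneg (‖a - b‖ - ‖c - d‖), h3]
  rw [ennnorm_sq_eq_ofReal, ennnorm_sq_eq_ofReal, ennnorm_sq_eq_ofReal, ennnorm_sq_eq_ofReal,
    ← ENNReal.ofReal_ofNat 3, ← ENNReal.ofReal_mul (by norm_num), ← ENNReal.ofReal_mul (by norm_num),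
    ← ENNReal.ofReal_mul (by norm_num), ← ENNReal.ofReal_add (by positivity) (by positivity),
    ← ENNReal.ofReal_add (by positivity) (by positivity)]
  exact ENNReal.ofReal_le_ofReal h2

/-! ### Normalising an admissible function, with control of the wave function -/

/-- **Normalisation.** A `C¹`, Dirichlet, symmetric `G` with `0 < ∫|G|² ≤ 1` normalises to a trial
state `Θ = c G`, `c ≥ 0` real, of energy `(∫|G|²)⁻¹ Q_v(G)` for every `v`, with
`∫|Θ - G|² ≤ 1 - ∫|G|²` (`(1 - ‖G‖)² ≤ 1 - ‖G‖²`). [folklore] -/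
theorem exists_normalize {ℓ : ℝ} {G : Config N → ℂ} (hG : ContDiff ℝ 1 G)
    (hG0 : ∀ X, X ∉ boxN N ℓ → G X = 0)
    (hGσ : ∀ (σ : Equiv.Perm (Fin N)) (X : Config N), G (X ∘ σ) = G X)
    (hm0 : ∫⁻ X, (‖G X‖₊ : ℝ≥0∞) ^ 2 ≠ 0) (hm1 : ∫⁻ X, (‖G X‖₊ : ℝ≥0∞) ^ 2 ≤ 1) :
    ∃ Θ : TrialState N ℓ, (∃ c : ℝ, 0 ≤ c ∧ Θ.ψ = fun X => (c : ℂ) * G X) ∧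
      (∀ v : ℝ → ℝ≥0∞, energy v Θ = (∫⁻ X, (‖G X‖₊ : ℝ≥0∞) ^ 2)⁻¹ *
        ∫⁻ X, kineticDensity G X + interaction v X * (‖G X‖₊ : ℝ≥0∞) ^ 2) ∧
      ∫⁻ X, (‖Θ.ψ X - G X‖₊ : ℝ≥0∞) ^ 2 ≤ 1 - ∫⁻ X, (‖G X‖₊ : ℝ≥0∞) ^ 2 := by
  -- adapted from `exists_cutoffTrialState` (…HardWallLimitCutoffState)
  set A : ℝ≥0∞ := ∫⁻ X, (‖G X‖₊ : ℝ≥0∞) ^ 2 with hA_def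
  have hAtop : A ≠ ⊤ := ne_top_of_le_ne_top ENNReal.one_ne_top hm1
  set a : ℝ := A.toReal with ha_def
  have ha0 : 0 < a := ENNReal.toReal_pos hm0 hAtop
  have ha1 : a ≤ 1 := by
    have := ENNReal.toReal_mono ENNReal.one_ne_top hm1
    rwa [ENNReal.toReal_one] at this
  have hAa : A = ENNReal.ofReal a := (ENNReal.ofReal_toReal hAtop).symm
  set s : ℝ := Real.sqrt a with hs_def
  have hs0 : 0 < s := Real.sqrt_pos.2 ha0
  have hs2 : s ^ 2 = a := Real.sq_sqrt ha0.le
  have hs1 : s ≤ 1 := by nlinarith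
  set c : ℝ := s⁻¹ with hc_def
  have hc0 : 0 ≤ c := by positivity
  have hc1 : 1 ≤ c := one_le_inv_iff₀.2 ⟨hs0, hs1⟩
  have hc2 : ENNReal.ofReal (c ^ 2) = A⁻¹ := by
    rw [hc_def, inv_pow, hs2, ENNReal.ofReal_inv_of_pos ha0, ← hAa]
  let Θ : TrialState N ℓ :=
    { ψ := fun X => (c : ℂ) * G X
      contDiff := contDiff_const.mul hG
      eq_zero := fun X hX => by
        show (c : ℂ) * G X = 0
        rw [hG0 X hX, mul_zero]
      symm := fun σ X => by
        show (c : ℂ) * G (X ∘ σ) = (c : ℂ) * G X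
        rw [hGσ σ X]
      norm_eq := by
        show ∫⁻ X, (‖(c : ℂ) * G X‖₊ : ℝ≥0∞) ^ 2 = 1
        simp only [ennorm_real_mul_sq c hc0]
        rw [lintegral_const_mul' _ _ ENNReal.ofReal_ne_top, hc2, ENNReal.inv_mul_cancel hm0 hAtop] }
  refine ⟨Θ, ⟨c, hc0, rfl⟩, fun v => ?_, ?_⟩
  · unfold energy
    rw [← lintegral_const_mul' _ _ (ENNReal.inv_ne_top.2 hm0), ← hc2]
    refine lintegral_congr fun X => ?_
    show kineticDensity (fun X => (c : ℂ) * G X) X +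
        interaction v X * (‖(c : ℂ) * G X‖₊ : ℝ≥0∞) ^ 2 = _
    rw [kineticDensity_const_mul hG c hc0, ennorm_real_mul_sq c hc0]
    ring
  · have e : ∀ X, (c : ℂ) * G X - G X = ((c - 1 : ℝ) : ℂ) * G X := fun X => by
      push_cast
      ring
    have hc1' : 0 ≤ c - 1 := by linarith
    show ∫⁻ X, (‖(c : ℂ) * G X - G X‖₊ : ℝ≥0∞) ^ 2 ≤ 1 - A
    simp only [e, ennorm_real_mul_sq (c - 1) hc1']
    rw [lintegral_const_mul' _ _ ENNReal.ofReal_ne_top, ← hA_def, hAa,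
      ← ENNReal.ofReal_mul (sq_nonneg _), ← ENNReal.ofReal_one, ← ENNReal.ofReal_sub _ ha0.le]
    refine ENNReal.ofReal_le_ofReal ?_
    have hid : (c - 1) ^ 2 * a = (1 - s) ^ 2 := by
      rw [hc_def, ← hs2]
      field_simp
    rw [hid]
    nlinarith


/-! ### The pair-collision cutoff of a bounded-energy Dirichlet state -/

/-- **`L²` distance of the cut state to the original state**: with `f = χ g`,
`∫|Θ - Φ|² ≤ 3 D₁ + 3 B² W + 3 η'` when `∫|Θ - f|² ≤ D₁`, `∫|g - Φ|² ≤ η'`, `|g| ≤ B` vanishing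
off the box and `vol{X ∈ Λ^N | χ X ≠ 1} ≤ W` (`|f - g| = (1 - χ)|g| ≤ B 1_{χ ≠ 1}`). [folklore] -/
theorem lintegral_cut_sub_sq_le {ℓ : ℝ} (Φ : TrialState N ℓ) {Θψ g : Config N → ℂ}
    {χ : Config N → ℝ} {B : ℝ≥0} {W η' D₁ : ℝ} (hΘm : Measurable Θψ) (hg1 : ContDiff ℝ 1 g)
    (hg0 : ∀ X, X ∉ boxN N ℓ → g X = 0) (hgB : ∀ X, ‖g X‖ ≤ B) (hχ1 : ContDiff ℝ 1 χ)
    (hχ01 : ∀ X, 0 ≤ χ X ∧ χ X ≤ 1)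
    (hvol : volume {X | X ∈ boxN N ℓ ∧ χ X ≠ 1} ≤ ENNReal.ofReal W)
    (hgL2 : ∫⁻ X, (‖g X - Φ.ψ X‖₊ : ℝ≥0∞) ^ 2 ≤ ENNReal.ofReal η')
    (hd1 : ∫⁻ X, (‖Θψ X - (χ X : ℂ) * g X‖₊ : ℝ≥0∞) ^ 2 ≤ ENNReal.ofReal D₁)
    (hW : 0 ≤ W) (hη' : 0 ≤ η') (hD₁ : 0 ≤ D₁) :
    ∫⁻ X, (‖Θψ X - Φ.ψ X‖₊ : ℝ≥0∞) ^ 2 ≤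
      ENNReal.ofReal (3 * D₁ + 3 * ((B : ℝ) ^ 2 * W) + 3 * η') := by
  have hd2 : ∫⁻ X, (‖(χ X : ℂ) * g X - g X‖₊ : ℝ≥0∞) ^ 2 ≤ (B : ℝ≥0∞) ^ 2 * ENNReal.ofReal W := by
    have hpt : ∀ X, (‖(χ X : ℂ) * g X - g X‖₊ : ℝ≥0∞) ^ 2 ≤
        {X | X ∈ boxN N ℓ ∧ χ X ≠ 1}.indicator (fun _ => ((B : ℝ≥0∞)) ^ 2) X := by
      intro X
      by_cases hX : X ∈ {X | X ∈ boxN N ℓ ∧ χ X ≠ 1}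
      · rw [indicator_of_mem hX]
        have h1 : (χ X : ℂ) * g X - g X = ((χ X - 1 : ℝ) : ℂ) * g X := by push_cast; ring
        refine pow_le_pow_left' ?_ 2
        rw [h1, ← ENNReal.ofReal_coe_nnreal, ← ENNReal.ofReal_coe_nnreal, coe_nnnorm, norm_mul,
          Complex.norm_real, Real.norm_eq_abs, abs_sub_comm,
          abs_of_nonneg (by linarith [(hχ01 X).2])]
        exact ENNReal.ofReal_le_ofReal
          ((mul_le_of_le_one_left (norm_nonneg _) (by linarith [(hχ01 X).1])).trans (hgB X))
      · rw [indicator_of_notMem hX]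
        have h1 : (χ X : ℂ) * g X - g X = 0 := by
          by_cases hb : X ∈ boxN N ℓ
          · have hc : χ X = 1 := by
              by_contra hc
              exact hX ⟨hb, hc⟩
            rw [hc]; push_cast; ring
          · rw [hg0 X hb]; ring
        rw [h1, nnnorm_zero, ENNReal.coe_zero, zero_pow two_ne_zero]
    calc ∫⁻ X, (‖(χ X : ℂ) * g X - g X‖₊ : ℝ≥0∞) ^ 2
        ≤ ∫⁻ X, {X | X ∈ boxN N ℓ ∧ χ X ≠ 1}.indicator (fun _ => ((B : ℝ≥0∞)) ^ 2) X :=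
          lintegral_mono hpt
      _ ≤ ((B : ℝ≥0∞)) ^ 2 * volume {X | X ∈ boxN N ℓ ∧ χ X ≠ 1} :=
          lintegral_indicator_const_le _ _
      _ ≤ _ := mul_le_mul' le_rfl hvol
  have hfm : Measurable fun X => (χ X : ℂ) * g X :=
    ((Complex.ofRealCLM.contDiff.comp hχ1).mul hg1).continuous.measurable
  have hgm : Measurable g := hg1.continuous.measurable
  have hmeas1 : Measurable fun X => 3 * (‖Θψ X - (χ X : ℂ) * g X‖₊ : ℝ≥0∞) ^ 2 :=
    ((hΘm.sub hfm).nnnorm.coe_nnreal_ennreal.pow_const 2).const_mul 3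
  have hmeas2 : Measurable fun X => 3 * (‖(χ X : ℂ) * g X - g X‖₊ : ℝ≥0∞) ^ 2 :=
    ((hfm.sub hgm).nnnorm.coe_nnreal_ennreal.pow_const 2).const_mul 3
  have e3 : ∀ x : ℝ, 0 ≤ x → (3 : ℝ≥0∞) * ENNReal.ofReal x = ENNReal.ofReal (3 * x) :=
    fun x _ => by rw [ENNReal.ofReal_mul (by norm_num), ENNReal.ofReal_ofNat]
  have eB : ((B : ℝ≥0∞)) ^ 2 * ENNReal.ofReal W = ENNReal.ofReal ((B : ℝ) ^ 2 * W) := by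
    rw [coe_nnreal_sq, ← ENNReal.ofReal_mul (sq_nonneg _)]
  have hBW : 0 ≤ (B : ℝ) ^ 2 * W := by positivity
  calc ∫⁻ X, (‖Θψ X - Φ.ψ X‖₊ : ℝ≥0∞) ^ 2
      ≤ ∫⁻ X, 3 * (‖Θψ X - (χ X : ℂ) * g X‖₊ : ℝ≥0∞) ^ 2 +
          3 * (‖(χ X : ℂ) * g X - g X‖₊ : ℝ≥0∞) ^ 2 + 3 * (‖g X - Φ.ψ X‖₊ : ℝ≥0∞) ^ 2 :=
        lintegral_mono fun X => ennnorm_sub_sq_le_three _ _ _ _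
    _ = 3 * (∫⁻ X, (‖Θψ X - (χ X : ℂ) * g X‖₊ : ℝ≥0∞) ^ 2) +
          3 * (∫⁻ X, (‖(χ X : ℂ) * g X - g X‖₊ : ℝ≥0∞) ^ 2) +
          3 * ∫⁻ X, (‖g X - Φ.ψ X‖₊ : ℝ≥0∞) ^ 2 := by
        have hmeas12 : Measurable fun X => 3 * (‖Θψ X - (χ X : ℂ) * g X‖₊ : ℝ≥0∞) ^ 2 +
            3 * (‖(χ X : ℂ) * g X - g X‖₊ : ℝ≥0∞) ^ 2 := hmeas1.add hmeas2
        rw [lintegral_add_left hmeas12, lintegral_add_left hmeas1,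
          lintegral_const_mul' _ _ (by norm_num), lintegral_const_mul' _ _ (by norm_num),
          lintegral_const_mul' _ _ (by norm_num)]
    _ ≤ 3 * ENNReal.ofReal D₁ + 3 * (((B : ℝ≥0∞)) ^ 2 * ENNReal.ofReal W) +
          3 * ENNReal.ofReal η' := by gcongr
    _ = ENNReal.ofReal (3 * D₁ + 3 * ((B : ℝ) ^ 2 * W) + 3 * η') := by
        rw [eB, e3 _ hD₁, e3 _ hBW, e3 _ hη', ← ENNReal.ofReal_add (by positivity) (by positivity),
          ← ENNReal.ofReal_add (by positivity) (by positivity)]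

/-- Real bookkeeping of the pair-collision cutoff: the form bound `q ≤ (1+θ)e + X` and the mass
bound `1 ≤ (1+θ)μ + 2Y` give `q ≤ μ(e + τ)` once `θ, X, Y` are small against `τ` and `K ≥ e`.
[folklore] -/
theorem collision_bookkeeping {e K τ θ X Y q μ : ℝ} (he : 0 ≤ e) (heK : e ≤ K) (hτ : 0 < τ)
    (hθ0 : 0 < θ) (hθ1 : θ ≤ 1) (hθK : 3 * θ * K ≤ τ / 8) (hX0 : 0 ≤ X) (hX : 2 * X ≤ τ / 8)
    (hY0 : 0 ≤ Y) (hY1 : 2 * Y ≤ 1 / 4) (hYK : 2 * Y * K ≤ τ / 8)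
    (hq : q ≤ (1 + θ) * e + X) (hμ : 1 ≤ (1 + θ) * μ + 2 * Y) :
    0 < μ ∧ q ≤ μ * (e + τ) := by
  have hμ1 : 3 / 4 ≤ (1 + θ) * μ := by linarith
  have hμ0 : 0 < μ := by
    by_contra h
    push Not at h
    nlinarith
  refine ⟨hμ0, ?_⟩
  have h1 : (1 + θ) * q ≤ (1 + θ) * ((1 + θ) * e + X) :=
    mul_le_mul_of_nonneg_left hq (by linarith)
  have h2 : (1 + θ) * ((1 + θ) * e + X) ≤ (1 - 2 * Y) * (e + τ) := by
    have hθθ : θ * θ ≤ θ := mul_le_of_le_one_right hθ0.le hθ1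
    have hθe : θ * θ * e ≤ θ * e := mul_le_mul_of_nonneg_right hθθ he
    have hθe' : θ * e ≤ θ * K := mul_le_mul_of_nonneg_left heK hθ0.le
    have hYe : Y * e ≤ Y * K := mul_le_mul_of_nonneg_left heK hY0
    have hθX : θ * X ≤ X := mul_le_of_le_one_left hX0 hθ1
    have hYτ : Y * τ ≤ 1 / 8 * τ := mul_le_mul_of_nonneg_right (by linarith) hτ.le
    nlinarith
  have h3 : (1 - 2 * Y) * (e + τ) ≤ (1 + θ) * μ * (e + τ) :=
    mul_le_mul_of_nonneg_right (by linarith) (by linarith)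
  by_contra h
  push Not at h
  have h4 : (1 + θ) * (μ * (e + τ)) < (1 + θ) * q := mul_lt_mul_of_pos_left h (by linarith)
  nlinarith

/-- **The pair-collision cut state at fixed data** (anchor of this auxiliary block). Given the
collision cutoff `χ` at radius `ε₁` (with its exceptional-volume and gradient bounds `A ε₁` on a
reference box `Λ_{L₀}^N` — `stub_pairCutoff`), the amplitude-truncation scheme at level `B` and
tolerance `ηt` (`stub_truncHigh`), a truncation level `n ≥ Cv ≥ sup_{[ε₁,∞)} v`, and small
parameters `θ, ρ` tied to the slack `τ` and the energy ceiling `K₁`, every trial state `Φ` of a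
cube of side `ℓ ≤ L₀` with `energy v Φ ≤ K₁` is within `τ` (energy from above, and `L²` distance
squared) of a trial state `Θ` of the same cube SUPPORTED OFF THE `ε₁`-NEIGHBOURHOOD OF THE
COLLISION SET: `Θ` is the normalised cut state `χ g` (form bound `EnergyTrunc.form_le`, mass bound
`EnergyTrunc.mass_le`, `collision_bookkeeping`, `lintegral_cut_sub_sq_le`).
[cite: LSSY2005, proof of Thm 2.4] -/
theorem stub_hardWallLimit_locallyBounded_aux : ∀ {N : ℕ} {L₀ ℓ : ℝ}, ℓ ≤ L₀ → ∀ {v : ℝ → ℝ≥0∞}, Measurable v → ∀ {K₁ τ θ ηt ε₁ ρ : ℝ} {A B Cv : ℝ≥0} {n : ℕ} {χ : Config N → ℝ}, 0 ≤ K₁ → 0 < τ → 0 < θ → θ ≤ 1 → 3 * θ * K₁ ≤ τ / 8 → 3 * θ ≤ τ / 8 → 0 < ηt → (1 + θ⁻¹) * ηt ≤ ρ → (1 + θ⁻¹) * ((B : ℝ) ^ 2 * A * ε₁) ≤ ρ → ρ ≤ 1 / 16 → ρ ≤ τ / 64 → ρ * K₁ ≤ τ / 64 → 0 ≤ ε₁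 → (∀ (L : ℝ) (Ψ : TrialState N L), ∫⁻ X, kineticDensity Ψ.ψ X ≤ (Real.toNNReal K₁ : ℝ≥0∞) → ∃ g : Config N → ℂ, ContDiff ℝ 1 g ∧ (∀ X, X ∉ boxN N L → g X = 0) ∧ (∀ (σ : Equiv.Perm (Fin N)) (X : Config N), g (X ∘ σ) = g X) ∧ (∀ X, ‖g X‖ ≤ B) ∧ (∀ X, ‖g X‖ ≤ ‖Ψ.ψ X‖) ∧ (∀ X, kineticDensity g X ≤ kineticDensity Ψ.ψ X) ∧ ∫⁻ X, (‖g X - Ψ.ψ X‖₊ : ℝ≥0∞) ^ 2 ≤ ENNReal.ofReal ηt) → ContDiff ℝ 1 χ → (∀ X, 0 ≤ χ X ∧ χ X ≤ 1) → (∀ (σ : Equiv.Perm (Fin N)) (X : Config N), χ (X ∘ σ) = χ X) → (∀ X : Config N, (∃ i j : Fin N, i ≠ j ∧ dist (X i) (X j) ≤ ε₁) → χ X = 0) → volume {X : Config N | X ∈ boxN N L₀ ∧ χ X ≠ 1} ≤ A * ENNReal.ofReal ε₁ → ∫⁻ X in boxN N L₀, realKinetic χ X ≤ A * ENNReal.ofReal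 ε₁ → (∀ s : ℝ, ε₁ ≤ s → v s ≤ Cv) → (Cv : ℝ≥0∞) ≤ (n : ℝ≥0∞) → ∀ Φ : TrialState N ℓ, energy v Φ ≤ ENNReal.ofReal K₁ → ∃ Θ : TrialState N ℓ, energy v Θ ≤ energy v Φ + ENNReal.ofReal τ ∧ ∫⁻ X, (‖Θ.ψ X - Φ.ψ X‖₊ : ℝ≥0∞) ^ 2 ≤ ENNReal.ofReal τ ∧ ∀ X, Θ.ψ X ≠ 0 → ∀ i j : Fin N, i ≠ j → ε₁ < dist (X i) (X j) := by
  intro N L₀ ℓ hℓ v hvm K₁ τ θ η' ε₁ ρ A B C' n χ hK₁ hτ hθ0 hθ1 hθK hθτ hη'0 hη'ρ hXρ hρ1 hρτ hρK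
    hε0 hB hχ1 hχ01 hχσ hχ0 hχvol hχkin hC' hCn Φ hΦ
  have hM1 : 1 ≤ 1 + θ⁻¹ := le_add_of_nonneg_right (inv_nonneg.2 hθ0.le)
  -- ### the amplitude truncation `g` of `Φ` and the cut state `f = χ g`
  have hkinΦ : ∫⁻ X, kineticDensity Φ.ψ X ≤ (Real.toNNReal K₁ : ℝ≥0∞) :=
    (le_self_add.trans_eq (energy_eq_kinetic_add v Φ).symm).trans hΦ
  obtain ⟨g, hg1, hg0, hgσ, hgB, hgΦ, hgk, hgL2⟩ := hB ℓ Φ hkinΦ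
  have hfar : ∀ X, χ X ≠ 0 → ∀ i j : Fin N, i ≠ j → ε₁ < dist (X i) (X j) := by
    intro X hX i j hij
    by_contra hcon
    exact hX (hχ0 X ⟨i, j, hij, not_lt.1 hcon⟩)
  have hV : ∀ X, χ X ≠ 0 → interaction v X = interaction (fun r => min (v r) (n : ℝ≥0∞)) X :=
    fun X hX => interaction_eq_trunc hC' hCn (hfar X hX)
  have hf1 : ContDiff ℝ 1 fun X => (χ X : ℂ) * g X :=
    (Complex.ofRealCLM.contDiff.comp hχ1).mul hg1
  have hf0 : ∀ X, X ∉ boxN N ℓ → (χ X : ℂ) * g X = 0 := fun X hX => by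
    rw [hg0 X hX, mul_zero]
  have hfσ : ∀ (σ : Equiv.Perm (Fin N)) (X : Config N),
      (χ (X ∘ σ) : ℂ) * g (X ∘ σ) = (χ X : ℂ) * g X := fun σ X => by
    rw [hχσ σ X, hgσ σ X]
  set m : ℝ≥0∞ := ∫⁻ X, (‖(χ X : ℂ) * g X‖₊ : ℝ≥0∞) ^ 2 with hm_def
  set Q : ℝ≥0∞ := ∫⁻ X, kineticDensity (fun Y => (χ Y : ℂ) * g Y) X +
      interaction v X * (‖(χ X : ℂ) * g X‖₊ : ℝ≥0∞) ^ 2 with hQ_def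
  have hm1 : m ≤ 1 := by
    calc m ≤ ∫⁻ X, (‖Φ.ψ X‖₊ : ℝ≥0∞) ^ 2 := by
          refine lintegral_mono fun X => pow_le_pow_left' (ENNReal.coe_le_coe.2
            ((nnnorm_cut_le hχ01 g X).trans ?_)) 2
          rw [← NNReal.coe_le_coe, coe_nnnorm, coe_nnnorm]
          exact hgΦ X
      _ = 1 := Φ.norm_eq
  have hmt : m ≠ ⊤ := ne_top_of_le_ne_top ENNReal.one_ne_top hm1
  -- the cutoff bounds on the smaller box
  have hW : A * ENNReal.ofReal ε₁ = ENNReal.ofReal (A * ε₁) := by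
    rw [ENNReal.ofReal_mul A.coe_nonneg, ENNReal.ofReal_coe_nnreal]
  have hvol : volume {X | X ∈ boxN N ℓ ∧ χ X ≠ 1} ≤ ENNReal.ofReal (A * ε₁) :=
    ((measure_mono (show {X | X ∈ boxN N ℓ ∧ χ X ≠ 1} ⊆ {X | X ∈ boxN N L₀ ∧ χ X ≠ 1} from
      fun X hX => ⟨boxN_subset_boxN hℓ hX.1, hX.2⟩)).trans hχvol).trans_eq hW
  have hkin : ∫⁻ X in boxN N ℓ, realKinetic χ X ≤ ENNReal.ofReal (A * ε₁) :=
    ((lintegral_mono_set (boxN_subset_boxN hℓ)).trans hχkin).trans_eq hW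
  -- ### the energy of `Φ` in `ℝ`
  have hEtop : energy v Φ ≠ ⊤ := ne_top_of_le_ne_top ENNReal.ofReal_ne_top hΦ
  set e : ℝ := (energy v Φ).toReal with he_def
  have he0 : 0 ≤ e := ENNReal.toReal_nonneg
  have heK : e ≤ K₁ := ENNReal.toReal_le_of_le_ofReal hK₁ hΦ
  have hEe : energy v Φ = ENNReal.ofReal e := (ENNReal.ofReal_toReal hEtop).symm
  have hEtrunc : energy (fun r => min (v r) (n : ℝ≥0∞)) Φ ≤ ENNReal.ofReal e :=
    (lintegral_mono fun _ => add_le_add le_rfl (mul_le_mul' (Finset.sum_le_sum fun _ _ =>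
      Finset.sum_le_sum fun _ _ => min_le_left _ _) le_rfl)).trans_eq hEe
  have hAε : 0 ≤ (A : ℝ) * ε₁ := mul_nonneg A.coe_nonneg hε0
  set X : ℝ := (1 + θ⁻¹) * ((B : ℝ) ^ 2 * (A * ε₁)) with hX_def
  have hXρ' : X ≤ ρ := by rw [hX_def, ← mul_assoc ((B : ℝ) ^ 2)]; exact hXρ
  have hX0 : 0 ≤ X := by rw [hX_def]; positivity
  set Y : ℝ := (1 + θ⁻¹) * η' + X with hY_def
  have hY0 : 0 ≤ Y := by rw [hY_def]; positivity
  have hYρ : Y ≤ 2 * ρ := by linarith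
  -- ### the form bound
  have hR1 : ENNReal.ofReal ((1 + θ) * e + X) =
      ENNReal.ofReal (1 + θ) * ENNReal.ofReal e +
        ENNReal.ofReal (1 + θ⁻¹) * (B : ℝ≥0∞) ^ 2 * ENNReal.ofReal (A * ε₁) := by
    rw [ENNReal.ofReal_add (by positivity : (0 : ℝ) ≤ (1 + θ) * e) hX0,
      ENNReal.ofReal_mul (by positivity : (0 : ℝ) ≤ 1 + θ), hX_def,
      ENNReal.ofReal_mul (by positivity : (0 : ℝ) ≤ 1 + θ⁻¹),
      ENNReal.ofReal_mul (by positivity : (0 : ℝ) ≤ (B : ℝ) ^ 2), ← coe_nnreal_sq, mul_assoc]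
  have hQle : Q ≤ ENNReal.ofReal ((1 + θ) * e + X) := by
    rw [hR1]
    calc Q ≤ _ := form_le hvm Φ hg1 hg0 hgB hgΦ hgk hχ1 hχ01 hV hθ0
      _ ≤ _ := add_le_add (mul_le_mul' le_rfl hEtrunc) (mul_le_mul' le_rfl hkin)
  have hQt : Q ≠ ⊤ := ne_top_of_le_ne_top ENNReal.ofReal_ne_top hQle
  have hq : Q.toReal ≤ (1 + θ) * e + X := ENNReal.toReal_le_of_le_ofReal (by positivity) hQle
  -- ### the mass bound
  have hR2 : ENNReal.ofReal ((1 + θ) * m.toReal + 2 * (1 + θ⁻¹) * (η' + (B : ℝ) ^ 2 * (A * ε₁))) =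
      ENNReal.ofReal (1 + θ) * m + ENNReal.ofReal (2 * (1 + θ⁻¹)) *
        (ENNReal.ofReal η' + (B : ℝ≥0∞) ^ 2 * ENNReal.ofReal (A * ε₁)) := by
    rw [ENNReal.ofReal_add (by positivity : (0 : ℝ) ≤ (1 + θ) * m.toReal)
        (by positivity : (0 : ℝ) ≤ 2 * (1 + θ⁻¹) * (η' + (B : ℝ) ^ 2 * (A * ε₁))),
      ENNReal.ofReal_mul (by positivity : (0 : ℝ) ≤ 1 + θ), ENNReal.ofReal_toReal hmt,
      ENNReal.ofReal_mul (by positivity : (0 : ℝ) ≤ 2 * (1 + θ⁻¹)),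
      ENNReal.ofReal_add hη'0.le (by positivity : (0 : ℝ) ≤ (B : ℝ) ^ 2 * (A * ε₁)),
      ENNReal.ofReal_mul (by positivity : (0 : ℝ) ≤ (B : ℝ) ^ 2), ← coe_nnreal_sq]
  have hμle : (1 : ℝ≥0∞) ≤ ENNReal.ofReal ((1 + θ) * m.toReal +
      2 * (1 + θ⁻¹) * (η' + (B : ℝ) ^ 2 * (A * ε₁))) := by
    rw [hR2]
    calc (1 : ℝ≥0∞) ≤ _ := mass_le Φ hg1 hg0 hgB hχ1 hχ01 hθ0
      _ ≤ _ := add_le_add le_rfl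
          (mul_le_mul' le_rfl (add_le_add hgL2 (mul_le_mul' le_rfl hvol)))
  have hμ : 1 ≤ (1 + θ) * m.toReal + 2 * Y := by
    have := ENNReal.one_le_ofReal.1 hμle
    have e2 : 2 * (1 + θ⁻¹) * (η' + (B : ℝ) ^ 2 * (A * ε₁)) = 2 * Y := by
      rw [hY_def, hX_def]; ring
    linarith
  -- ### bookkeeping and normalisation
  obtain ⟨hμ0, hqμ⟩ := collision_bookkeeping he0 heK hτ hθ0 hθ1 hθK hX0 (by linarith) hY0
    (by linarith) (by nlinarith [mul_le_mul_of_nonneg_right hYρ hK₁]) hq hμ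
  have hm0 : m ≠ 0 := fun h => by
    rw [h, ENNReal.toReal_zero] at hμ0
    exact lt_irrefl 0 hμ0
  obtain ⟨Θ, ⟨c, -, hΘψ⟩, hΘE, hΘd⟩ := exists_normalize hf1 hf0 hfσ hm0 hm1
  refine ⟨Θ, ?_, ?_, ?_⟩
  · -- the energy
    rw [hΘE v]
    calc m⁻¹ * Q ≤ m⁻¹ * (m * ENNReal.ofReal (e + τ)) := by
          gcongr
          rw [← ENNReal.ofReal_toReal hQt, ← ENNReal.ofReal_toReal hmt,
            ← ENNReal.ofReal_mul ENNReal.toReal_nonneg]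
          exact ENNReal.ofReal_le_ofReal hqμ
      _ = ENNReal.ofReal (e + τ) := by rw [← mul_assoc, ENNReal.inv_mul_cancel hm0 hmt, one_mul]
      _ = energy v Φ + ENNReal.ofReal τ := by rw [ENNReal.ofReal_add he0 hτ.le, ← hEe]
  · -- the distance
    have h1m : 1 - m ≤ ENNReal.ofReal (θ + 2 * Y) := by
      rw [← ENNReal.ofReal_toReal hmt, ← ENNReal.ofReal_one,
        ← ENNReal.ofReal_sub _ ENNReal.toReal_nonneg]
      refine ENNReal.ofReal_le_ofReal ?_
      have hμ1 : m.toReal ≤ 1 := by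
        have := ENNReal.toReal_mono ENNReal.one_ne_top hm1
        rwa [ENNReal.toReal_one] at this
      linarith [mul_le_of_le_one_right hθ0.le hμ1]
    have hd1 : ∫⁻ X, (‖Θ.ψ X - (χ X : ℂ) * g X‖₊ : ℝ≥0∞) ^ 2 ≤ ENNReal.ofReal (θ + 2 * Y) := by
      beta_reduce at hΘd
      exact hΘd.trans h1m
    have hfin : 3 * (θ + 2 * Y) + 3 * ((B : ℝ) ^ 2 * (A * ε₁)) + 3 * η' ≤ τ := by
      have hBX : (B : ℝ) ^ 2 * (A * ε₁) ≤ X := by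
        rw [hX_def]
        exact le_mul_of_one_le_left (by positivity) hM1
      have hη'le : η' ≤ ρ := (le_mul_of_one_le_left hη'0.le hM1).trans hη'ρ
      linarith
    exact (lintegral_cut_sub_sq_le Φ Θ.contDiff.continuous.measurable hg1 hg0 hgB hχ1 hχ01
      hvol hgL2 hd1 hAε hη'0.le (by positivity)).trans (ENNReal.ofReal_le_ofReal hfin)
  · -- the support
    intro X hX i j hij
    rw [hΘψ] at hX
    have hχX : χ X ≠ 0 := fun h0 => hX (by simp [h0])
    exact hfar X hχX i j hij

end Summit.AtomisticToContinuum.BoseEinsteinCondensation.RimSqueeze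

end
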